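import Summits.CriticalPhenomena.PercolationContinuityZ3.Theorems.Transplant.AutChartCriticalContinuity
import Summits.CriticalPhenomena.PercolationContinuityZ3.Theorems.Transplant.PathMapCustomers
import Literature.Probability.Percolation.GrimmettMarstrand
import Literature.Probability.Percolation.SiteSubgraphMonotonicity
import HarnessLib

/-!
# The hypothesis side for COBOUNDED orbits (quasi-transitive actions, stabilisers arbitrary): `p_c(G) < 1` — UNCONDITIONAL

builds on p205010 (kernel theorem, internal audit signed; external expert review pending) — nothing in this file uses p205010, and the theorem of this
file is UNCONDITIONAL (no open node).  Lane `prim-bschramm`, seat `prim-bschramm-p4` gen 25 (PART C3 of `P4-GENERAL.md` §47.10).  Helper file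
(`--supports stmt-CriticalPhenomena-4575 --as helper`).

THE STATEMENT (`AutChart.criticalProb_lt_one_of_cobounded`).  `G` connected, locally finite; `A` acting on `V(G)` by automorphisms (stabilisers ARBITRARY)
such that the orbit of `t` is `R`-DENSE (`∀ w ∃ a, w ∈ B(a • t, R)` — e.g. finitely many orbits, `criticalProb_lt_one_of_finite_orbits`); `c : A → ℤ²` of
rank-two image killing `Stab(t)`.  Then `p_c(G, v) < 1` at every vertex — so Conj. 4 restricted to this class is never vacuous (in print this follows from
superlinear growth, DGRSY 2020, a NAMED fact in the tree; here it is kernel).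
THE PROOF.  The orbit `O = A • t` with the ORBIT RIPS GRAPH `H = (Rips_{2R+1} G)[O]` (`u ~ v` iff `0 < d_G(u,v) ≤ 2R+1`) is connected (shadow a `G`-walk by
nearest orbit points), locally finite, and `A` acts on it by automorphisms TRANSITIVELY with the same stabiliser of `t`; gen 25's `AutChart.criticalProb_lt_one`
gives `p_c(H) < 1`; the inclusion `O ↪ V` is a rough embedding of bounded-degree graphs (edges ↦ walks of length `≤ 2R+1`, fibres `≤ 1`), so gen 24's
`GraphPathMap.criticalProb_lt_one_of_lipschitz` (Lyons–Peres Thm 7.15, remark) transfers `p_c < 1` to `G`; other vertices by `criticalProb_eq_of_reachable`.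
[cite: BenjaminiSchramm1996, §2 Conj. 1; Thm. 1] [cite: LyonsPeres2016, §7.4 Thm. 7.15 and the remark following it] [cite: Hutchcroft2016, Thm. 2]
-/

noncomputable section

namespace Summit.CriticalPhenomena.PercolationContinuityZ3.Theorems.Transplant

open SimpleGraph Filter Literature.Barriers.CriticalPhenomena Literature.Probability.LatticeModels Literature.Probability.Percolation
open scoped Classical

namespace AutChart

variable {V : Type} {G : SimpleGraph V} {A : Type} [Group A] [MulAction A V] {t : V}

/-! ## The orbit Rips graph -/

/-- **The orbit Rips graph** at scale `m`: the Rips graph of `G` induced on the orbit `A • t`. [folklore] -/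
abbrev orbitRips (G : SimpleGraph V) (A : Type) [Group A] [MulAction A V] (t : V) (m : ℕ) : SimpleGraph (MulAction.orbit A t) :=
  (AutMilnor.rips G m).induce (MulAction.orbit A t)

/-- Adjacency in the orbit Rips graph. [folklore] -/
theorem orbitRips_adj {m : ℕ} {x y : MulAction.orbit A t} :
    (orbitRips G A t m).Adj x y ↔ ((x : V) ≠ y ∧ (y : V) ∈ graphBall G x m) := by
  rw [induce_adj, AutMilnor.rips_adj]

/-- The orbit Rips graph of a locally finite graph is locally finite. [folklore] -/
instance orbitRips_locallyFinite [G.LocallyFinite] (m : ℕ) : (orbitRips G A t m).LocallyFinite :=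
  locallyFiniteComap (AutMilnor.rips G m) Subtype.val_injective

/-- `A` acts on the orbit Rips graph by automorphisms. [folklore] -/
theorem orbitRips_isActionByAut (hact : IsActionByAut G A) (m : ℕ) : IsActionByAut (orbitRips G A t m) A := by
  intro g x y
  rw [orbitRips_adj, orbitRips_adj, MulAction.orbit.coe_smul, MulAction.orbit.coe_smul]
  exact AutMilnor.rips_isActionByAut hact m g x y

/-- The base point of the orbit. [folklore] -/
def obase (A : Type) [Group A] [MulAction A V] (t : V) : MulAction.orbit A t := ⟨t, MulAction.mem_orbit_self t⟩

/-- `A` acts transitively on the orbit. [folklore] -/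
theorem orbit_transitive (x : MulAction.orbit A t) : ∃ a : A, a • obase A t = x := by
  obtain ⟨a, ha⟩ := MulAction.mem_orbit_iff.1 x.2
  exact ⟨a, Subtype.ext (by rw [MulAction.orbit.coe_smul]; exact ha)⟩

/-- The stabiliser of the base point of the orbit is the stabiliser of `t`. [folklore] -/
theorem mem_stabilizer_obase_iff (h : A) : h ∈ MulAction.stabilizer A (obase A t) ↔ h ∈ MulAction.stabilizer A t := by
  rw [MulAction.mem_stabilizer_iff, MulAction.mem_stabilizer_iff, Subtype.ext_iff, MulAction.orbit.coe_smul]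
  rfl

/-- Close orbit points are joined in the orbit Rips graph. [folklore] -/
theorem orbitRips_reachable_of_mem {m : ℕ} {x y : MulAction.orbit A t} (h : (y : V) ∈ graphBall G x m) : (orbitRips G A t m).Reachable x y := by
  by_cases hxy : x = y
  · subst hxy; exact Reachable.refl _
  · exact (orbitRips_adj.2 ⟨fun e => hxy (Subtype.ext e), h⟩).reachable

/-- **The orbit Rips graph at scale `2R+1` of an `R`-dense orbit is connected** (shadow a `G`-walk by nearest orbit points). [folklore] -/
theorem orbitRips_connected (hc : G.Connected) {R : ℕ} (hR : ∀ w : V, ∃ a : A, w ∈ graphBall G (a • t) R) :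
    (orbitRips G A t (2 * R + 1)).Connected := by
  -- shadowing: a walk `u ⇝ v` with `u ∈ B(x, R)`, `v ∈ B(y, R)` for orbit points `x, y` gives `x ⇝ y` in the orbit Rips graph
  have key : ∀ {u v : V} (w : G.Walk u v) (x y : MulAction.orbit A t), u ∈ graphBall G x R → v ∈ graphBall G y R →
      (orbitRips G A t (2 * R + 1)).Reachable x y := by
    intro u v w
    induction w with
    | nil =>
      intro x y hu hv
      refine orbitRips_reachable_of_mem (graphBall_mono _ _ (by omega) (mem_graphBall_add G hu ((mem_graphBall_comm G).1 hv)))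
    | @cons a b _ hab w ih =>
      intro x y hu hv
      obtain ⟨g, hg⟩ := hR b
      have hz : (⟨g • t, MulAction.mem_orbit _ _⟩ : MulAction.orbit A t) = g • obase A t := Subtype.ext rfl
      have h1 : (orbitRips G A t (2 * R + 1)).Reachable x ⟨g • t, MulAction.mem_orbit _ _⟩ := by
        refine orbitRips_reachable_of_mem ?_
        have hab' : b ∈ graphBall G a 1 := mem_graphBall_one_of_adj G hab
        have := mem_graphBall_add G (mem_graphBall_add G hu hab') ((mem_graphBall_comm G).1 hg)
        exact graphBall_mono _ _ (by omega) this
      exact h1.trans (ih _ y hg hv)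
  refine (connected_iff _).2 ⟨fun x y => ?_, ⟨obase A t⟩⟩
  obtain ⟨w⟩ := hc.preconnected (x : V) (y : V)
  exact key w x y (mem_graphBall_self G _ R) (mem_graphBall_self G _ R)

/-- **Degrees of `G` are bounded when one orbit is dense** (every vertex is a translate of a vertex of the finite ball `B(t, R)`). [folklore] -/
theorem degree_le_of_cobounded [G.LocallyFinite] (hact : IsActionByAut G A) {R : ℕ} (hR : ∀ w : V, ∃ a : A, w ∈ graphBall G (a • t) R) (w : V) :
    G.degree w ≤ (graphBall_finite G t R).toFinset.sup (fun u => G.degree u) := by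
  obtain ⟨a, ha⟩ := hR w
  have hw : a⁻¹ • w ∈ graphBall G t R := by
    have := (smul_mem_graphBall_iff hact a⁻¹).2 ha
    rwa [inv_smul_smul] at this
  have hdeg : G.degree w = G.degree (a⁻¹ • w) := by rw [← smulIso_apply hact a⁻¹ w, Iso.degree_eq]
  rw [hdeg]
  exact Finset.le_sup (f := fun u => G.degree u) ((Set.Finite.mem_toFinset _).2 hw)

/-! ## The theorem -/

/-- **UNCONDITIONAL — `p_c(G) < 1` for an `R`-DENSE orbit with a rank-two character killing its stabiliser** (stabilisers arbitrary): the orbit Rips graph is a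
transitive instance of gen 25's `criticalProb_lt_one`, and `p_c < 1` transfers to `G` along the rough embedding `O ↪ V` (Lyons–Peres Thm 7.15, remark;
gen 24's `GraphPathMap.criticalProb_lt_one_of_lipschitz`). [cite: BenjaminiSchramm1996, §2 Conj. 1; Thm. 1] [cite: LyonsPeres2016, §7.4 Thm. 7.15]
[cite: Hutchcroft2016, Thm. 2] -/
theorem criticalProb_lt_one_of_cobounded [G.LocallyFinite] (hact : IsActionByAut G A) (hc : G.Connected) (t : V) {R : ℕ}
    (hR : ∀ w : V, ∃ a : A, w ∈ graphBall G (a • t) R) (c : A →* Multiplicative (Site 2)) (hstab : ∀ h ∈ MulAction.stabilizer A t, c h = 1)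
    (hrank : ∃ a b : A, MaxArea.det2 (Multiplicative.toAdd (c a)) (Multiplicative.toAdd (c b)) ≠ 0) (v : V) : criticalProb G v < 1 := by
  haveI : Countable V := countable_of_connected_of_locallyFinite G hc t
  have hactH := orbitRips_isActionByAut (t := t) hact (2 * R + 1)
  have hcH := orbitRips_connected (A := A) (t := t) hc hR
  have hstabH : ∀ h ∈ MulAction.stabilizer A (obase A t), c h = 1 := fun h hh => hstab h ((mem_stabilizer_obase_iff h).1 hh)
  have hpcH : criticalProb (orbitRips G A t (2 * R + 1)) (obase A t) < 1 :=
    criticalProb_lt_one hactH hcH (obase A t) orbit_transitive c hstabH hrank (obase A t)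
  -- transfer along the inclusion `O ↪ V`
  have hpc : criticalProb G ((fun x : MulAction.orbit A t => (x : V)) (obase A t)) < 1 := by
    refine GraphPathMap.criticalProb_lt_one_of_lipschitz (H := orbitRips G A t (2 * R + 1)) (G := G) (fun x => (x : V))
      (L := 2 * R + 1) (K := 1) (DH := (orbitRips G A t (2 * R + 1)).degree (obase A t))
      (DG := (graphBall_finite G t R).toFinset.sup (fun u => G.degree u)) ?_ ?_ ?_ (degree_le_of_cobounded hact hR) (obase A t) hpcH
    · intro x y hxy
      exact (orbitRips_adj.1 hxy).2
    · intro w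
      have hsub : ((fun x : MulAction.orbit A t => (x : V)) ⁻¹' {w}).Subsingleton := fun x hx y hy =>
        Subtype.ext ((Set.mem_singleton_iff.1 hx).trans (Set.mem_singleton_iff.1 hy).symm)
      exact ⟨hsub.finite, (Set.ncard_le_one hsub.finite).2 fun a ha b hb => hsub ha hb⟩
    · intro u
      obtain ⟨a, rfl⟩ := orbit_transitive u
      rw [← smulIso_apply hactH a (obase A t), Iso.degree_eq]
  have e : criticalProb G v = criticalProb G t := criticalProb_eq_of_reachable G (hc.preconnected v t)
  rw [e]
  exact hpc

/-- **UNCONDITIONAL — finitely many orbits**: if every vertex is an `A`-translate of one of finitely many representatives (a quasi-transitive action,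
stabilisers arbitrary) and some orbit's stabiliser is killed by a character of rank two, then `p_c(G, v) < 1` at every vertex.
[cite: BenjaminiSchramm1996, §2 Conj. 1 (quasi-transitive graphs)] [cite: LyonsPeres2016, §7.4 Thm. 7.15] -/
theorem criticalProb_lt_one_of_finite_orbits [G.LocallyFinite] (hact : IsActionByAut G A) (hc : G.Connected) (t : V) (reps : Finset V)
    (hreps : ∀ w : V, ∃ a : A, ∃ r ∈ reps, a • r = w) (c : A →* Multiplicative (Site 2)) (hstab : ∀ h ∈ MulAction.stabilizer A t, c h = 1)
    (hrank : ∃ a b : A, MaxArea.det2 (Multiplicative.toAdd (c a)) (Multiplicative.toAdd (c b)) ≠ 0) (v : V) : criticalProb G v < 1 := by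
  -- every representative is at finite distance from `t`; take the maximum
  have hdist : ∀ r : V, ∃ n : ℕ, r ∈ graphBall G t n := fun r => by
    obtain ⟨w⟩ := hc.preconnected t r
    exact ⟨w.length, w, le_rfl⟩
  choose n hn using hdist
  refine criticalProb_lt_one_of_cobounded hact hc t (R := reps.sup n) (fun w => ?_) c hstab hrank v
  obtain ⟨a, r, hr, rfl⟩ := hreps w
  refine ⟨a, (smul_mem_graphBall_iff hact a).2 (graphBall_mono _ _ (Finset.le_sup (f := n) hr) (hn r))⟩

end AutChart

end Summit.CriticalPhenomena.PercolationContinuityZ3.Theorems.Transplant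

end
-- build-touch 2026-08-25T10:13:28Z T1-B (lead g18, cohort named in T1-C): re-land of p395792, declarations byte-identical
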